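import Mathlib.Algebra.MvPolynomial.PDeriv
import Mathlib.Algebra.MvPolynomial.CommRing
import Mathlib.RingTheory.Derivation.Lie
import Literature.RepresentationTheory.Virasoro.VirasoroModule

/-!
# The bosonic Fock space and the Feigin–Fuchs (free boson) Virasoro operators

The Heisenberg algebra `[a_m, a_n] = m δ_{m+n,0}` acts on the **bosonic Fock space**
`F^μ = R[x₁, x₂, …]` over a commutative ring `R` by `a_{-k} = x_k ·` (creation), `a_k = k ∂/∂x_k`
(annihilation), `k ≥ 1`, and `a_0 = μ` (Iohara–Koga §4.1.1, `F^η` with `|η⟩ = 1`). For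
`λ, μ ∈ R` the **Feigin–Fuchs / free-boson Virasoro operators** are (Iohara–Koga (4.1)–(4.3),
`T_λ(z) = ½ :a(z)²: + λ ∂a(z)`)

  `L_n = ½ Σ_{j ∈ ℤ} :a_{n-j} a_j: - λ (n + 1) a_n`,

which we realise as honest (finite) differential operators on `R[x₁, x₂, …]`
(`Fock.L`): writing `x_0 := 0`, `∂_0 := 0`,

* `L_n 1 = P_n := ½ Σ_{i+j=-n} x_i x_j + (μ - λ(1+n)) x_{-n}` (zero for `n > 0`), the pure
  creation part, acting by multiplication;
* the derivation part `D_n : x_k ↦ k x_{k-n} + δ_{n,k} (μ - λ(n+1)) n` (the terms `a_{-i} a_j`,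
  `a_0 a_n`, `λ a_n`);
* the pure annihilation part `A_n = ½ Σ_{i+j=n} (i ∂_i)(j ∂_j)` (zero for `n < 2`);
* the vacuum energy `h = ½ μ² - λ μ = ½ μ (μ - 2λ)` on `L_0` (Iohara–Koga (4.4)).

This file: the definitions and the commutators with the Heisenberg generators,
`[L_n, a_j] = -j a_{n+j} - λ n (n+1) δ_{n+j,0}` (`Fock.lie_L_a`; Iohara–Koga Lemma 4.4 with
`V = a`, i.e. `a(z)` is primary of weight `1` up to the anomaly `λ`). The Virasoro relations with
central charge `c_λ = 1 - 12 λ²` (Iohara–Koga (4.2), Proposition 4.1) are derived from these in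
`Literature.RepresentationTheory.Virasoro.FockModule`.
-/

noncomputable section

namespace Literature.RepresentationTheory.Virasoro

namespace Fock

open MvPolynomial

variable (R : Type*) [CommRing R]

/-- The **bosonic Fock space** `R[x₁, x₂, …]` (`x_k` = `a_{-k}|μ⟩`), polynomials in variables
indexed by the positive integers. [cite: IoharaKoga2011, §4.1.1 and eq. (4.6)] -/
abbrev Space : Type _ := MvPolynomial ℕ+ R

/-- The variable `x_k` for `k ≥ 1`, extended by `x_0 := 0`. [folklore] -/
def x (k : ℕ) : Space R := if h : 0 < k then X ⟨k, h⟩ else 0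

/-- The partial derivative `∂_k = ∂/∂x_k` for `k ≥ 1` (a derivation), extended by `∂_0 := 0`.
[folklore] -/
def d (k : ℕ) : Derivation R (Space R) (Space R) := if h : 0 < k then pderiv ⟨k, h⟩ else 0

variable {R}

/-- `x_0 = 0` by convention. [folklore] -/
@[simp] theorem x_zero : x R 0 = 0 := by simp [x]

/-- `x_k = X_k` for `k ≥ 1`. [folklore] -/
theorem x_of_pos {k : ℕ} (hk : 0 < k) : x R k = X ⟨k, hk⟩ := by simp [x, hk]

/-- `x_k = X_k` for `k : ℕ+`. [folklore] -/
@[simp] theorem x_coe (k : ℕ+) : x R k = X k := by simp [x, k.pos]; rfl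

/-- `∂_0 = 0` by convention. [folklore] -/
@[simp] theorem d_zero : d R 0 = 0 := by simp [d]

/-- `∂_k = ∂/∂X_k` for `k ≥ 1`. [folklore] -/
theorem d_of_pos {k : ℕ} (hk : 0 < k) : d R k = pderiv ⟨k, hk⟩ := by simp [d, hk]

/-- `∂_k = ∂/∂X_k` for `k : ℕ+`. [folklore] -/
@[simp] theorem d_coe (k : ℕ+) : d R k = pderiv k := by simp [d, k.pos]; rfl

/-- `∂_j x_k = δ_{jk}` (`k ≥ 1`), `= 0` for `k = 0`. [folklore] -/
theorem d_x (j k : ℕ) : d R j (x R k) = if j = k ∧ 0 < k then 1 else 0 := by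
  classical
  by_cases hk : 0 < k
  · by_cases hj : 0 < j
    · rw [d_of_pos hj, x_of_pos hk, pderiv_X]
      by_cases hjk : j = k
      · subst hjk; simp [hj]
      · rw [Pi.single_eq_of_ne (by intro h; exact hjk (by simpa using congrArg PNat.val h.symm))]
        simp [hjk]
    · have hj0 : j = 0 := by omega
      subst hj0
      simp [hk.ne]
  · have hk0 : k = 0 := by omega
    subst hk0
    simp

/-- `∂_j X_k = δ_{jk}`. [folklore] -/
theorem d_X (j : ℕ) (k : ℕ+) : d R j (X k) = if j = k then 1 else 0 := by
  rw [← x_coe, d_x]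
  simp [k.pos]

/-- `∂_j` kills constants. [folklore] -/
@[simp] theorem d_C (j : ℕ) (r : R) : d R j (C r) = 0 := derivation_C _ _

/-! ### Operators on the Fock space: multiplication operators and derivations -/

/-- Multiplication by a polynomial, as an `R`-linear operator on the Fock space (the creation
operators are `a_{-k} = m (x k)`). [folklore] -/
abbrev m (p : Space R) : Module.End R (Space R) := LinearMap.mulLeft R p

/-- `[D, p·] = (D p)·` for a derivation `D`. [folklore] -/
theorem der_mul_m (Dv : Derivation R (Space R) (Space R)) (p : Space R) :
    (Dv : Module.End R (Space R)) * m p = m p * (Dv : Module.End R (Space R)) + m (Dv p) := by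
  refine LinearMap.ext fun q => ?_
  change Dv (p * q) = p * Dv q + Dv p * q
  rw [Derivation.leibniz, smul_eq_mul, smul_eq_mul]
  ring

/-- `[D₁ D₂, p·] = (D₂ p)· D₁ + (D₁ p)· D₂ + (D₁ D₂ p)·` for derivations `D₁, D₂`. [folklore] -/
theorem der_der_mul_m (D₁ D₂ : Derivation R (Space R) (Space R)) (p : Space R) :
    (D₁ : Module.End R (Space R)) * D₂ * m p =
      m p * ((D₁ : Module.End R (Space R)) * D₂) + m (D₂ p) * (D₁ : Module.End R (Space R)) +
        m (D₁ p) * (D₂ : Module.End R (Space R)) + m (D₁ (D₂ p)) := by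
  rw [mul_assoc, der_mul_m, mul_add, ← mul_assoc, der_mul_m, add_mul, der_mul_m]
  simp only [mul_assoc]
  abel

/-- The commutator of two derivations of the polynomial ring is the derivation with the expected
values on the variables. [folklore] -/
theorem der_mul_der_sub (D₁ D₂ : Derivation R (Space R) (Space R)) :
    (D₁ : Module.End R (Space R)) * D₂ - (D₂ : Module.End R (Space R)) * D₁ =
      (mkDerivation R fun i => D₁ (D₂ (X i)) - D₂ (D₁ (X i)) :
        Derivation R (Space R) (Space R)) := by
  have h1 : (⁅D₁, D₂⁆ : Derivation R (Space R) (Space R)) =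
      mkDerivation R fun i => D₁ (D₂ (X i)) - D₂ (D₁ (X i)) :=
    derivation_ext fun i => by simp [Derivation.commutator_apply]
  rw [← h1, Derivation.commutator_coe_linear_map, Ring.lie_def]

/-- The partial derivatives commute. [folklore] -/
theorem d_mul_d (i j : ℕ) :
    (d R i : Module.End R (Space R)) * d R j = (d R j : Module.End R (Space R)) * d R i := by
  rw [← sub_eq_zero, der_mul_der_sub]
  have : (mkDerivation R fun k => d R i (d R j (X k)) - d R j (d R i (X k))) = 0 :=
    derivation_ext fun k => by simp [d_X, apply_ite]
  rw [this]
  rfl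

/-- Multiplication by a constant is a scalar. [folklore] -/
theorem m_C (r : R) : m (C r : Space R) = r • (1 : Module.End R (Space R)) := by
  refine LinearMap.ext fun q => ?_
  change C r * q = r • q
  rw [MvPolynomial.smul_eq_C_mul]

/-- `m` is additive. [folklore] -/
theorem m_add (p q : Space R) : m (p + q) = m p + m q :=
  LinearMap.ext fun r => by change (p + q) * r = p * r + q * r; ring

/-- `m` is `R`-linear. [folklore] -/
theorem m_smul (r : R) (p : Space R) : m (r • p) = r • m p :=
  LinearMap.ext fun q => by change (r • p) * q = r • (p * q); rw [smul_mul_assoc]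

/-- Multiplication by `0` is `0`. [folklore] -/
@[simp] theorem m_zero : m (0 : Space R) = 0 := LinearMap.ext fun q => by change 0 * q = 0; ring

/-- Multiplication by `1` is the identity. [folklore] -/
@[simp] theorem m_one : m (1 : Space R) = 1 := LinearMap.ext fun q => by change 1 * q = q; ring

/-- Multiplication operators commute. [folklore] -/
theorem m_mul_m (p q : Space R) : m p * m q = m q * m p :=
  LinearMap.ext fun r => by change p * (q * r) = q * (p * r); ring

/-! ### The Heisenberg generators -/

section Heisenberg

variable (mu : R)

variable (R) in
/-- The **Heisenberg generators** on the Fock space: `a_{-k} = x_k ·`, `a_k = k ∂_k` (`k ≥ 1`),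
`a_0 = μ`. [cite: IoharaKoga2011, §4.1.1 and Lemma 4.3 (explicit action)] -/
def a (j : ℤ) : Module.End R (Space R) :=
  m (x R (-j).toNat) + ((j.toNat : ℕ) : R) • (d R j.toNat : Module.End R (Space R)) +
    (if j = 0 then mu else 0) • 1

/-- `a_{-k} = x_k ·` for `k ≥ 1`. [cite: IoharaKoga2011, Lemma 4.3] -/
theorem a_neg (k : ℕ+) : a R mu (-(k : ℤ)) = m (X k) := by
  have h2 : (-(k : ℤ)).toNat = 0 := by simp
  simp [a, h2]

/-- `a_k = k ∂_k` for `k ≥ 1`. [cite: IoharaKoga2011, Lemma 4.3] -/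
theorem a_pos (k : ℕ+) :
    a R mu k = (k : R) • ((pderiv k : Derivation R (Space R) (Space R)) : Module.End R (Space R)) := by
  have h1 : (-(k : ℤ)).toNat = 0 := by simp
  simp [a, h1]

/-- `a_0 = μ`. [cite: IoharaKoga2011, §4.1.1] -/
theorem a_zero : a R mu 0 = mu • (1 : Module.End R (Space R)) := by
  simp [a]

end Heisenberg

/-! ### The Feigin–Fuchs Virasoro operators -/

section Virasoro

variable [Algebra ℂ R]

variable (R) in
/-- `½ ∈ R` (`R` is a `ℂ`-algebra). [folklore] -/
def half : R := algebraMap ℂ R 2⁻¹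

/-- `2 · ½ = 1`. [folklore] -/
theorem two_mul_half : (2 : R) * half R = 1 := by
  rw [half, ← map_ofNat (algebraMap ℂ R) 2, ← map_mul, mul_inv_cancel₀ two_ne_zero, map_one]

/-- `½ + ½ = 1`. [folklore] -/
theorem half_add_half : half R + half R = 1 := by rw [← two_mul, two_mul_half]

variable (R) in
/-- The quadratic creation polynomial `½ Σ_{i+j=N} x_i x_j = ½ Σ_{i+j=N} a_{-i} a_{-j} |μ⟩`
(`i, j ≥ 1`; the terms `i ∈ {0, N}` vanish as `x_0 = 0`). [cite: IoharaKoga2011, eqs. (4.1)–(4.3)] -/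
def quad (N : ℕ) : Space R := half R • ∑ i ∈ Finset.range (N + 1), x R i * x R (N - i)

variable (R) in
/-- The pure annihilation part `A_N = ½ Σ_{i+j=N} (i ∂_i)(j ∂_j) = ½ Σ_{i+j=N} a_i a_j` of `L_N`
(`N ≥ 2`; zero for `N ≤ 1`). [cite: IoharaKoga2011, eqs. (4.1)–(4.3)] -/
def aa (N : ℕ) : Module.End R (Space R) :=
  ∑ i ∈ Finset.range (N + 1),
    (half R * i * ((N : R) - i)) • ((d R i : Module.End R (Space R)) * d R (N - i))

variable (lam mu : R)

variable (R) in
/-- The creation polynomial `P_n = L_n |μ⟩ = ½ Σ_{i+j=-n} x_i x_j + (μ - λ(1+n)) x_{-n}` (`n < 0`;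
zero for `n ≥ 0`): the terms `½ a_{-i} a_{-j}`, `a_{-n}·a_0 = μ x_{-n}` and `-λ(n+1) a_n` of `L_n`.
[cite: IoharaKoga2011, eqs. (4.1)–(4.3)] -/
def P (n : ℤ) : Space R := quad R (-n).toNat + (mu - lam * (1 + n)) • x R (-n).toNat

variable (R) in
/-- The value on `x_i` of the derivation part of `L_n`:
`D_n x_i = i x_{i-n} + δ_{n,i} (μ - λ(n+1)) n` (the terms `a_{-(i-n)} · i∂_i`, and for `i = n`
the terms `a_0 a_n = μ n ∂_n`, `-λ(n+1) a_n`). [cite: IoharaKoga2011, eqs. (4.1)–(4.3)] -/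
def dc (n : ℤ) (i : ℕ+) : Space R :=
  (i : R) • x R ((i : ℤ) - n).toNat + if n = (i : ℤ) then C ((mu - lam * (n + 1)) * n) else 0

variable (R) in
/-- The derivation part `D_n` of `L_n`. [cite: IoharaKoga2011, eqs. (4.1)–(4.3)] -/
def D (n : ℤ) : Derivation R (Space R) (Space R) := mkDerivation R (dc R lam mu n)

variable (R) in
/-- The vacuum energy `h = ½ μ² - λ μ = ½ μ (μ - 2λ)` (`L_0 |μ⟩ = h |μ⟩`). [cite: IoharaKoga2011, eq. (4.4)] -/
def hval : R := half R * mu ^ 2 - lam * mu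

variable (R) in
/-- The **Feigin–Fuchs (free boson with background charge `λ`) Virasoro operator**
`L_n = ½ Σ_j :a_{n-j} a_j: - λ(n+1) a_n` on the Fock space `R[x₁, x₂, …]` with `a_0 = μ`, written
as the differential operator `P_n · + D_n + A_n + δ_{n,0} h`.
[cite: IoharaKoga2011, eqs. (4.1)–(4.3) (T_λ(z) = ½:a(z)²: + λ∂a(z) = Σ L_n^λ z^{-n-2})] -/
def L (n : ℤ) : Module.End R (Space R) :=
  m (P R lam mu n) + (D R lam mu n : Module.End R (Space R)) + aa R n.toNat +
    (if n = 0 then hval R lam mu else 0) • 1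

/-! ### Commutators of the pieces of `L_n` with the Heisenberg generators -/

omit [Algebra ℂ R] in
/-- `D_n x_k = k x_{k-n} + δ_{n,k} (μ - λ(n+1)) n` (also for `k = 0`, both sides being `0`).
[cite: IoharaKoga2011, eqs. (4.1)–(4.3)] -/
theorem D_x (n : ℤ) (k : ℕ) :
    D R lam mu n (x R k) =
      (k : R) • x R (((k : ℤ) - n).toNat) + if n = (k : ℤ) then C ((mu - lam * (n + 1)) * n) else 0 := by
  by_cases hk : 0 < k
  · rw [x_of_pos hk, D, mkDerivation_X, dc]
    simp
  · have hk0 : k = 0 := by omega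
    subst hk0
    simp only [x_zero, map_zero, Nat.cast_zero, zero_smul, zero_add]
    split_ifs with h
    · subst h; simp
    · rfl

/-- `∂_j (½ Σ_{i+i'=N} x_i x_{i'}) = x_{N-j}` (`j ≥ 1`; zero if `j ≥ N`). [folklore] -/
theorem d_quad (N j : ℕ) (hj : 0 < j) : d R j (quad R N) = x R (N - j) := by
  have key : ∀ i ∈ Finset.range (N + 1),
      d R j (x R i * x R (N - i)) =
        (if j = N - i ∧ 0 < N - i then x R i else 0) + (if j = i ∧ 0 < i then x R (N - i) else 0) := by
    intro i _
    rw [Derivation.leibniz, d_x, d_x, smul_eq_mul, smul_eq_mul, mul_ite, mul_ite, mul_one, mul_zero,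
      mul_one, mul_zero]
  have hsum2 : ∑ i ∈ Finset.range (N + 1), (if j = i ∧ 0 < i then x R (N - i) else 0) = x R (N - j) := by
    have : ∀ i ∈ Finset.range (N + 1), (if j = i ∧ 0 < i then x R (N - i) else 0) =
        if j = i then x R (N - i) else 0 := by
      intro i _
      by_cases h : j = i
      · subst h; simp [hj]
      · simp [h]
    rw [Finset.sum_congr rfl this, Finset.sum_ite_eq]
    split_ifs with h
    · rfl
    · rw [Finset.mem_range, not_lt] at h
      rw [Nat.sub_eq_zero_of_le (by omega), x_zero]
  have hsum1 : ∑ i ∈ Finset.range (N + 1), (if j = N - i ∧ 0 < N - i then x R i else 0) = x R (N - j) := by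
    rw [← Finset.sum_range_reflect]
    rw [← hsum2]
    refine Finset.sum_congr rfl fun i hi => ?_
    rw [Finset.mem_range] at hi
    have e : N + 1 - 1 - i = N - i := by omega
    have e' : N - (N - i) = i := by omega
    rw [e, e']
  rw [quad, Derivation.map_smul, map_sum, Finset.sum_congr rfl key, Finset.sum_add_distrib, hsum1,
    hsum2, ← two_smul R (x R (N - j)), smul_smul, mul_comm, two_mul_half, one_smul]

/-- `∂_j P_n = x_{-n-j} + δ_{-n,j} (μ - λ(1+n))` for `j ≥ 1`. [folklore] -/
theorem d_P (n : ℤ) (j : ℕ) (hj : 0 < j) :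
    d R j (P R lam mu n) =
      x R ((-n).toNat - j) + if (-n).toNat = j then C (mu - lam * (1 + n)) else 0 := by
  rw [P, map_add, d_quad _ _ hj, Derivation.map_smul, d_x]
  congr 1
  by_cases h : (-n).toNat = j
  · rw [if_pos ⟨h.symm, by omega⟩, if_pos h, MvPolynomial.C_eq_smul_one]
  · rw [if_neg (fun h' => h h'.1.symm), if_neg h, smul_zero]

/-- The annihilation part commutes with the annihilators. [folklore] -/
theorem aa_mul_d (N k : ℕ) :
    aa R N * (d R k : Module.End R (Space R)) = (d R k : Module.End R (Space R)) * aa R N := by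
  unfold aa
  rw [Finset.sum_mul, Finset.mul_sum]
  refine Finset.sum_congr rfl fun i _ => ?_
  rw [smul_mul_assoc, mul_smul_comm]
  congr 1
  rw [mul_assoc, d_mul_d (N - i) k, ← mul_assoc, d_mul_d i k, mul_assoc]

/-- `[A_N, x_k·] = k (N - k) ∂_{N-k}` (`= ½·2·` the two cross terms; zero unless `1 ≤ k < N`).
[folklore] -/
theorem aa_mul_m_x_sub (N k : ℕ) :
    aa R N * m (x R k) - m (x R k) * aa R N =
      ((k : R) * ((N : R) - k)) • (d R (N - k) : Module.End R (Space R)) := by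
  have key : ∀ i ∈ Finset.range (N + 1),
      (half R * i * ((N : R) - i)) • ((d R i : Module.End R (Space R)) * d R (N - i)) * m (x R k) -
        m (x R k) * ((half R * i * ((N : R) - i)) • ((d R i : Module.End R (Space R)) * d R (N - i))) =
      (if k = N - i ∧ 0 < k then (half R * i * ((N : R) - i)) • (d R i : Module.End R (Space R)) else 0) +
      (if k = i ∧ 0 < k then (half R * i * ((N : R) - i)) • (d R (N - i) : Module.End R (Space R))
        else 0) := by
    intro i _
    have h0 : d R i (if N - i = k ∧ 0 < k then (1 : Space R) else 0) = 0 := by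
      split_ifs <;> simp
    rw [smul_mul_assoc, mul_smul_comm, der_der_mul_m, d_x, d_x, h0, m_zero, add_zero, smul_add,
      smul_add, add_assoc, add_sub_cancel_left]
    congr 1
    · by_cases h1 : N - i = k ∧ 0 < k
      · rw [if_pos h1, if_pos ⟨h1.1.symm, h1.2⟩, m_one, one_mul]
      · rw [if_neg h1, if_neg (fun h => h1 ⟨h.1.symm, h.2⟩), m_zero, zero_mul, smul_zero]
    · by_cases h2 : i = k ∧ 0 < k
      · rw [if_pos h2, if_pos ⟨h2.1.symm, h2.2⟩, m_one, one_mul]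
      · rw [if_neg h2, if_neg (fun h => h2 ⟨h.1.symm, h.2⟩), m_zero, zero_mul, smul_zero]
  have hsum2 : ∑ i ∈ Finset.range (N + 1),
      (if k = i ∧ 0 < k then (half R * i * ((N : R) - i)) • (d R (N - i) : Module.End R (Space R))
        else 0) = (half R * k * ((N : R) - k)) • (d R (N - k) : Module.End R (Space R)) := by
    by_cases hk : 0 < k
    · have : ∀ i ∈ Finset.range (N + 1),
          (if k = i ∧ 0 < k then (half R * i * ((N : R) - i)) • (d R (N - i) : Module.End R (Space R))
            else 0) =
          if k = i then (half R * i * ((N : R) - i)) • (d R (N - i) : Module.End R (Space R)) else 0 := by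
        intro i _; simp [hk]
      rw [Finset.sum_congr rfl this, Finset.sum_ite_eq]
      split_ifs with h
      · rfl
      · rw [Finset.mem_range, not_lt] at h
        rw [Nat.sub_eq_zero_of_le (by omega), d_zero]
        simp
    · have hk0 : k = 0 := by omega
      subst hk0
      simp
  have hsum1 : ∑ i ∈ Finset.range (N + 1),
      (if k = N - i ∧ 0 < k then (half R * i * ((N : R) - i)) • (d R i : Module.End R (Space R)) else 0) =
      (half R * k * ((N : R) - k)) • (d R (N - k) : Module.End R (Space R)) := by
    rw [← Finset.sum_range_reflect, ← hsum2]
    refine Finset.sum_congr rfl fun i hi => ?_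
    rw [Finset.mem_range] at hi
    have e : N + 1 - 1 - i = N - i := by omega
    have e' : N - (N - i) = i := by omega
    have e'' : ((N - i : ℕ) : R) = (N : R) - i := by rw [Nat.cast_sub (by omega)]
    rw [e, e', e'']
    congr 2
    ring
  rw [aa, Finset.sum_mul, Finset.mul_sum, ← Finset.sum_sub_distrib, Finset.sum_congr rfl key,
    Finset.sum_add_distrib, hsum1, hsum2, ← two_smul R, smul_smul]
  congr 1
  rw [← mul_assoc, ← mul_assoc, two_mul_half, one_mul]

omit [Algebra ℂ R] in
/-- `[∂_j, D_n] = (n + j) ∂_{n+j}` for `j ≥ 1` (zero if `n + j ≤ 0`). [folklore] -/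
theorem d_mul_D_sub (n : ℤ) (j : ℕ) (hj : 0 < j) :
    (d R j : Module.End R (Space R)) * D R lam mu n - (D R lam mu n : Module.End R (Space R)) * d R j =
      (((n + j).toNat : ℕ) : R) • (d R (n + j).toNat : Module.End R (Space R)) := by
  rw [der_mul_der_sub]
  have hD : (mkDerivation R fun i => d R j (D R lam mu n (X i)) - D R lam mu n (d R j (X i))) =
      (((n + j).toNat : ℕ) : R) • d R (n + j).toNat := by
    refine derivation_ext fun i => ?_
    have hi := i.pos
    rw [mkDerivation_X, d_X, Derivation.smul_apply, d_X]
    have h0 : D R lam mu n (if (j : ℕ) = i then (1 : Space R) else 0) = 0 := by split_ifs <;> simp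
    rw [h0, sub_zero, ← x_coe, D_x, map_add, Derivation.map_smul, d_x]
    have h1 : d R j (if n = ((i : ℕ) : ℤ) then C ((mu - lam * (n + 1)) * n) else (0 : Space R)) = 0 := by
      split_ifs <;> simp
    rw [h1, add_zero]
    by_cases h : (((i : ℕ) : ℤ) - n).toNat = j
    · have h' : (n + j).toNat = (i : ℕ) := by omega
      rw [if_pos ⟨h.symm, by omega⟩, h', if_pos rfl]
    · have h' : (n + j).toNat ≠ (i : ℕ) := by omega
      rw [if_neg (fun hh => h hh.1.symm), if_neg h', smul_zero, smul_zero]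
  rw [hD]
  rfl

/-! ### `[L_n, a_j] = -j a_{n+j} - λ n(n+1) δ_{n+j,0}` -/

/-- **The Heisenberg field is primary of weight one up to the anomaly**:
`[L_n, a_j] = -j a_{n+j} - λ n (n+1) δ_{n+j,0}` for all `n, j ∈ ℤ`.
[cite: IoharaKoga2011, Lemma 4.4 (with V_μ replaced by a(z): [L_n, a_j] from T_λ(z)a(w) OPE) and Proposition 4.1] -/
theorem lie_L_a (n j : ℤ) :
    L R lam mu n * a R mu j - a R mu j * L R lam mu n =
      (-(j : R)) • a R mu (n + j) - (if n + j = 0 then lam * n * (n + 1) else 0) • 1 := by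
  rcases lt_trichotomy j 0 with hj | rfl | hj
  · -- creation operator `a_j = x_k ·`, `k = -j ≥ 1`
    obtain ⟨k, rfl⟩ : ∃ k : ℕ+, j = -(k : ℤ) := ⟨⟨(-j).toNat, by omega⟩, by simp; omega⟩
    rw [a_neg, ← x_coe]
    have hL : L R lam mu n * m (x R k) - m (x R k) * L R lam mu n =
        m (D R lam mu n (x R k)) + ((k : R) * ((n.toNat : R) - k)) • (d R (n.toNat - k) : Module.End R (Space R)) := by
      rw [L]
      simp only [add_mul, mul_add]
      rw [m_mul_m, ← aa_mul_m_x_sub, smul_mul_assoc, mul_smul_comm, one_mul, mul_one]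
      have := der_mul_m (D R lam mu n) (x R k)
      rw [this]
      abel
    rw [hL, D_x, m_add, m_smul, a]
    have e1 : (-(n + -((k : ℕ) : ℤ))).toNat = ((((k : ℕ) : ℤ)) - n).toNat := by congr 1; ring
    have e2 : (n + -((k : ℕ) : ℤ)).toNat = n.toNat - k := by omega
    simp only [Int.cast_neg, Int.cast_natCast, neg_neg, e1, e2, smul_add]
    have e3 : ((k : ℕ) : R) • ((((n.toNat - k : ℕ) : ℕ) : R) • (d R (n.toNat - k) : Module.End R (Space R))) =
        ((k : R) * ((n.toNat : R) - k)) • (d R (n.toNat - k) : Module.End R (Space R)) := by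
      by_cases h : (k : ℕ) ≤ n.toNat
      · rw [smul_smul, Nat.cast_sub h]
      · rw [Nat.sub_eq_zero_of_le (by omega), d_zero]
        simp
    rw [e3]
    by_cases hnk : n = (k : ℕ)
    · subst hnk
      simp only [if_true, add_neg_cancel, m_C, smul_smul, Int.cast_natCast]
      module
    · have h2 : n + -((k : ℕ) : ℤ) ≠ 0 := by omega
      simp only [hnk, if_false, h2, m_zero, smul_zero, add_zero, sub_zero, zero_smul]
  · -- `a_0 = μ`
    rw [a_zero, add_zero, Int.cast_zero, neg_zero, zero_smul, zero_sub, mul_smul_comm, smul_mul_assoc,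
      mul_one, one_mul, sub_self]
    split_ifs with h
    · subst h; simp
    · simp
  · -- annihilation operator `a_j = j ∂_j`, `j ≥ 1`
    obtain ⟨k, rfl⟩ : ∃ k : ℕ+, j = (k : ℤ) := ⟨⟨j.toNat, by omega⟩, by simp; omega⟩
    rw [a_pos, ← d_coe]
    have hL : L R lam mu n * (d R k : Module.End R (Space R)) -
        (d R k : Module.End R (Space R)) * L R lam mu n =
        -(m (d R k (P R lam mu n))) -
          (((n + k).toNat : ℕ) : R) • (d R (n + k).toNat : Module.End R (Space R)) := by
      rw [← d_mul_D_sub lam mu n k k.pos, L]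
      simp only [add_mul, mul_add]
      rw [aa_mul_d, smul_mul_assoc, mul_smul_comm, one_mul, mul_one, der_mul_m (d R k) (P R lam mu n)]
      abel
    have hL' := congrArg (fun T : Module.End R (Space R) => ((k : ℕ) : R) • T) hL
    simp only [smul_sub] at hL'
    rw [mul_smul_comm, smul_mul_assoc, hL', d_P lam mu n k k.pos, m_add, a]
    have e1 : (-(n + ((k : ℕ) : ℤ))).toNat = (-n).toNat - k := by omega
    simp only [Int.cast_natCast, e1, smul_add, smul_neg, neg_smul]
    by_cases hnk : (-n).toNat = (k : ℕ)
    · have h2 : n + ((k : ℕ) : ℤ) = 0 := by omega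
      have h3 : n = -((k : ℕ) : ℤ) := by omega
      subst h3
      simp only [hnk, if_true, h2, m_C, smul_smul, Int.cast_neg, Int.cast_natCast]
      module
    · have h2 : n + ((k : ℕ) : ℤ) ≠ 0 := by omega
      simp only [hnk, if_false, h2, m_zero, smul_zero, add_zero, sub_zero, zero_smul, neg_zero]
      abel

end Virasoro

end Fock

end Literature.RepresentationTheory.Virasoro

end
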